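import Summits.CriticalPhenomena.PercolationContinuityZ3.Theorems.PercNearOneGluingNoHeavyLowerTailCILUnionExchangeSegmentNonempty
import HarnessLib

/-!
# `NoHeavyLowerTail` (stmt-CriticalPhenomena-4575) — the explaining-away floor: in the merged world the
# attachment of the observer never drops below its unconditioned rate in the world `W ↮ a`

Prover `prim-gen-induct` (gen 9), `--supports stmt-CriticalPhenomena-4575`.  No definitions, no named facts,
no sorries; standard axioms.

Setting as in `…CILUnionExchangeSegmentNonempty` (BLOBQUOTIENT.md §27–28): observer `o`, terminals `a₁, a₂`, avoided
vertex `a`; `U = {o ↔ a₁} ∪ {o ↔ a₂}`, `M = {a₁ ↔ a₂}`, `R = {a₁ ↮ a} ∩ {a₂ ↮ a}`, `A = {C_{a₁} ∈ 𝒜}` (`𝒜` upper).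
"Explaining away" (loc. cit. §27 (iii), §28 (iii)): given `M`, conditioning on an up-set `A` may DEcrease the probability of
`U` (two parallel `a₁–a₂` routes).  The floor proved here (row K5/K6 of prim/INEQ-CLAIMS.md):

* `UnionExchange.attach_given_merged_upset_ge` — `μ(R ∩ (A ∩ M)) · μ(R ∩ U) ≤ μ(R) · μ(R ∩ ((A ∩ M) ∩ U))`,
  i.e. `μ(U | A, M, R) ≥ μ(U | R) = π_R u + (1 − π_R)(t₁⁺ + t₂⁺) ≥ t₁⁺ + t₂⁺`: however strong the explaining away, the
  attachment rate of `o` given `A ∩ M` stays above the Π′-rate.  Proof: one application of positive association of the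
  glued cluster `C_{a₁,a₂}` given `R` (BHK Thm. 2.1 with sets; `A ∩ M` and `U` are increasing in `C_{a₁,a₂}`).
-/

noncomputable section

open MeasureTheory Set
open Literature.Probability.LatticeModels (prodBernoulli)
open Literature.Probability.Percolation Literature.Probability.Percolation.TwoSetExchange

namespace Summit.CriticalPhenomena.PercolationContinuityZ3.Theorems

namespace UnionExchange

variable {V : Type*} [Fintype V]

/-- **Explaining-away floor.**  With `R = {a₁ ↮ a} ∩ {a₂ ↮ a}`, `M = {a₁ ↔ a₂}`, `U = {o ↔ a₁} ∪ {o ↔ a₂}` and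
`A = {C_{a₁} ∈ 𝒜}` (`𝒜` an upper family):  `μ(R ∩ (A ∩ M)) · μ(R ∩ U) ≤ μ(R) · μ(R ∩ ((A ∩ M) ∩ U))`
(positive association of the glued cluster `C_{a₁,a₂}` given that it avoids `a`; `A ∩ M` and `U` are increasing in it). -/
theorem attach_given_merged_upset_ge (w : Sym2 V → unitInterval) (o a₁ a₂ a : V)
    {𝒜 : Set (Set (Sym2 V))} (h𝒜 : IsUpperSet 𝒜) :
    (prodBernoulli w).real (({ω : BondConfig V | ¬ (openGraph ω).Reachable a₁ a} ∩
          {ω | ¬ (openGraph ω).Reachable a₂ a}) ∩ ({ω | openEdgeCluster ω a₁ ∈ 𝒜} ∩ openConn a₁ a₂)) *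
      (prodBernoulli w).real (({ω : BondConfig V | ¬ (openGraph ω).Reachable a₁ a} ∩
          {ω | ¬ (openGraph ω).Reachable a₂ a}) ∩ (openConn o a₁ ∪ openConn o a₂)) ≤
    (prodBernoulli w).real ({ω : BondConfig V | ¬ (openGraph ω).Reachable a₁ a} ∩
          {ω | ¬ (openGraph ω).Reachable a₂ a}) *
      (prodBernoulli w).real (({ω : BondConfig V | ¬ (openGraph ω).Reachable a₁ a} ∩
          {ω | ¬ (openGraph ω).Reachable a₂ a}) ∩
        (({ω | openEdgeCluster ω a₁ ∈ 𝒜} ∩ openConn a₁ a₂) ∩ (openConn o a₁ ∪ openConn o a₂))) := by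
  classical
  have hS1 : a₁ ∈ ({a₁, a₂} : Set V) := by simp
  have hS2 : a₂ ∈ ({a₁, a₂} : Set V) := by simp
  have tA := typePlus_setOf_openEdgeCluster_mem ({a₁, a₂} : Set V) ({a} : Set V) hS1 h𝒜
  have tAM : ∀ ⦃ω ω' : BondConfig V⦄,
      (⋃ u ∈ ({a₁, a₂} : Set V), openEdgeCluster ω u) ⊆ (⋃ u ∈ ({a₁, a₂} : Set V), openEdgeCluster ω' u) →
      (⋃ u ∈ ({a} : Set V), openEdgeCluster ω' u) ⊆ (⋃ u ∈ ({a} : Set V), openEdgeCluster ω u) →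
      ω ∈ ({ω : BondConfig V | openEdgeCluster ω a₁ ∈ 𝒜} ∩ openConn a₁ a₂) →
        ω' ∈ ({ω : BondConfig V | openEdgeCluster ω a₁ ∈ 𝒜} ∩ openConn a₁ a₂) := by
    intro ω ω' h1 h2 h
    exact ⟨tA h1 h2 h.1, typePlus_openConn_of_mem ({a₁, a₂} : Set V) ({a} : Set V) hS1 a₂ h1 h2 h.2⟩
  have tU : ∀ ⦃ω ω' : BondConfig V⦄,
      (⋃ u ∈ ({a₁, a₂} : Set V), openEdgeCluster ω u) ⊆ (⋃ u ∈ ({a₁, a₂} : Set V), openEdgeCluster ω' u) →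
      (⋃ u ∈ ({a} : Set V), openEdgeCluster ω' u) ⊆ (⋃ u ∈ ({a} : Set V), openEdgeCluster ω u) →
      ω ∈ (openConn o a₁ ∪ openConn o a₂ : Set (BondConfig V)) →
        ω' ∈ (openConn o a₁ ∪ openConn o a₂ : Set (BondConfig V)) := by
    intro ω ω' h1 h2 h
    rcases h with h | h
    · have h' : ω ∈ (openConn a₁ o : Set (BondConfig V)) := (show (openGraph ω).Reachable o a₁ from h).symm
      have := typePlus_openConn_of_mem ({a₁, a₂} : Set V) ({a} : Set V) hS1 o h1 h2 h'
      exact Or.inl (show (openGraph ω').Reachable a₁ o from this).symm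
    · have h' : ω ∈ (openConn a₂ o : Set (BondConfig V)) := (show (openGraph ω).Reachable o a₂ from h).symm
      have := typePlus_openConn_of_mem ({a₁, a₂} : Set V) ({a} : Set V) hS2 o h1 h2 h'
      exact Or.inr (show (openGraph ω').Reachable a₂ o from this).symm
  have key := setTwoClusterExchange w ({a₁, a₂} : Set V) ({a} : Set V)
    (A₁ := {ω : BondConfig V | openEdgeCluster ω a₁ ∈ 𝒜} ∩ openConn a₁ a₂)
    (A₂ := (openConn o a₁ ∪ openConn o a₂ : Set (BondConfig V)))
    (B₁ := Set.univ) (B₂ := Set.univ) tAM tU (fun _ _ _ _ h => h) (fun _ _ _ _ h => h)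
  rw [sep_pair_singleton] at key
  simp only [inter_univ] at key
  linarith [key]

end UnionExchange

end Summit.CriticalPhenomena.PercolationContinuityZ3.Theorems
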